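import Mathlib
import Summits.Ventures.FusionMHD.Models.CerfonFreidbergNstxLikeQHalfForceBalance
import Summits.Ventures.FusionMHD.Models.FluxSurfacePolarRayLevelResistive
import HarnessLib

/-!
# Ventures/FusionMHD — Models/CerfonFreidbergNstxLikeQHalfResistive.lean: the Glasser–Greene–Johnson RESISTIVE-INTERCHANGE INDEX
# `D_R` of the surface `ψ_N = 1/2` (and every nearby level) of THE Cerfon–Freidberg NSTX-like flux in EIGHT θ-integral registers,
# full-loop and `[0, π]` (half-loop) forms, and `D_R < 0 ⇒` Mercier there

HONEST FRAMING (LADDER-GRIDFUSION three columns; CF rung; F3 scoping input R3 «GGJ regime» on a computed-shape surface; LOW, no count).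
Generic inputs (model-7): `Models/FluxSurfacePolarRayLevelResistive.lean` (`PolarRay.resistiveIndexE`, register form, `D_R < 0 ⇒`
Mercier), `…LevelForceBalance.lean`, `…LevelGGJHalf.lean` (half-loop registers); instance inputs: `…QHalfForceBalance.lean` (`fb_hyps`:
the Ampère/force-balance field hypotheses of THE flux discharged from `C²`), `…QHalfGGJ{,Half}.lean` (`Gfield`, parity).
* CERTIFIED (kernel; this file + imports, axioms standard): for every level `u` with `|u − u₀| < 10⁻¹²` of THE flux
  `CFNstxLike.U = cfSolution 0 coeff` (`Δ*CFNstxLike.U = X²`, `C = 1`, free constant `F`): `QHalf.resistiveIndex F u := PolarRay.resistiveIndexE F 1 CFNstxLike.U X_a 0 u`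
  (GGJ's `D_R = F + E + H²`, Zheng (3.42), of the volume/Hamada relabelling of the (8.134) record with the surface's own `⟨σB²⟩ = F`,
  `⟨B²⟩`); **`resistiveIndex_eq_registerForm`**: `D_R = −mercierRegisterForm F 1 Pd Wd Aσ As AB Ai/(4F²Pd²) + (−(Aσ − AB·W/A2)/Pd − 1/2)²`
  in EIGHT θ-integrals over `[0, 2π]` of closed-form kernels (`Dfield`, `F2field`, `Gfield`) along `ρ_u`;
  **`resistiveIndex_eq_registerForm_halfLoop`**: the SAME expression with the `[0, π]` registers (the NSTX-like chain's 32-panel shape; `D_R` is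
  scale-invariant in the registers); **`mercierCriterion_of_resistiveIndex_neg`**.  Hypotheses: `F ≠ 0`, shear `Pd ≠ 0`, `A2 ≠ 0`
  (the last two hold numerically — not computed in this cell for the NSTX-like surface — stated, not assumed silently).
* VALIDATED: nothing used; no value of `D_R` claimed (eight program registers + tube constants remain, model-5's lane).
* MODELLED: analytic Cerfon–Freidberg family; ideal-MHD inputs of the GGJ resistive layer (constant resistivity); statements about
  MODEL surfaces — never a device, never «stable».
Typer/prover: gridfusion-model-7 (g6; NSTX-like twin = the ITER-like text with the NSTX-like objects), 2026-08-27.  Citations: Zheng 2015 (2.64), (3.42) [Zheng2015]; Jardin 2010 (8.134) [Jardin2010].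
-/

noncomputable section

open Set MeasureTheory intervalIntegral Filter Topology
open Literature.MathematicalPhysics.MHD Literature.MathematicalPhysics.MHD.CerfonFreidberg Literature.MathematicalPhysics.MHD.GradShafranov
  Literature.MathematicalPhysics.MHD.FluxGeometry Literature.MathematicalPhysics.MHD.Mercier.FluxForm
open Summit.Ventures.FusionMHD.Models.PolarRay

namespace Summit.Ventures.FusionMHD.Models.CFNstxLike.QHalf

/-- THE RESISTIVE-INTERCHANGE INDEX `D_R` of the level surface `CFNstxLike.U = u` of THE CF NSTX-like flux (free constant `F`, `C = 1`).
MODELLED: GGJ resistive layer on ideal-MHD inputs of the analytic CF equilibrium. [cite: Zheng2015, §3.2 eq. (3.42)] -/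
def resistiveIndex (F u : ℝ) : ℝ := resistiveIndexE F 1 CFNstxLike.U CFNstxLike.Xa 0 u

/-- `Gfield` is jointly continuous on the boxes (it equals the Fréchet form `GfieldF` there). -/
theorem continuousOn_Gfield_box {k : ℕ} (hk : k < 64) :
    ContinuousOn (fun p : ℝ × ℝ => CFNstxLike.QHalf.Gfield p.1 p.2) (Icc (t64 k) (t64 (k + 1)) ×ˢ Icc (σ₁ k) (σ₂ k)) := by
  have hK : ∀ p ∈ Icc (t64 k) (t64 (k + 1)) ×ˢ Icc (σ₁ k) (σ₂ k), rayPoint CFNstxLike.Xa 0 p.1 p.2 ∈ ΩX :=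
    fun p hp => ray_mem p.1 (box_sub hk hp.2)
  have hL : ContinuousOn (fun p : ℝ × ℝ => fderiv ℝ Uxy (rayPoint CFNstxLike.Xa 0 p.1 p.2)) (Icc (t64 k) (t64 (k + 1)) ×ˢ Icc (σ₁ k) (σ₂ k)) :=
    (contDiffOn_Uxy.continuousOn_fderiv_of_isOpen isOpen_ΩX (by norm_num)).comp (continuous_rayPoint_uncurry CFNstxLike.Xa 0).continuousOn hK
  have hF2 : ContinuousOn (fun p : ℝ × ℝ => GfieldF p.1 p.2) (Icc (t64 k) (t64 (k + 1)) ×ˢ Icc (σ₁ k) (σ₂ k)) := by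
    unfold GfieldF
    exact ((hL.clm_apply continuousOn_const).pow 2).add ((hL.clm_apply continuousOn_const).pow 2)
  refine hF2.congr fun p hp => ?_
  show Gfield p.1 p.2 = GfieldF p.1 p.2
  rw [← box_factsG k hk p.1 hp.1 p.2 hp.2]
  rfl

section levels

variable {u : ℝ} (hu : u ∈ Ioo (u₀ - ((δQ : ℚ) : ℝ)) (u₀ + ((δQ : ℚ) : ℝ))) (F : ℝ)
include hu

/-- **`D_R` OF THE SURFACE `CFNstxLike.U = u` IN EIGHT REGISTERS** (full loop `[0, 2π]`): `Pd = ∫polarKernelDs/D`, `Wd = ∫volKernelDs/D`,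
`Aσ = ∫invGradKernel`, `As = ∫sigmaSqKernel`, `AB = ∫bsqGradKernel`, `Ai = ∫invBsqKernel`, `W = ∫volKernel`, `A2 = ∫bsqKernel`
along `ρ_u` with the fields `Dfield`, `F2field`, `Gfield`. [cite: Zheng2015, §3.2 eq. (3.42)] -/
theorem resistiveIndex_eq_registerForm (hF : F ≠ 0)
    (hPd : (∫ θ in (0 : ℝ)..(2 * Real.pi),
      polarKernelDs CFNstxLike.Xa Dfield F2field θ (rayRadius CFNstxLike.U CFNstxLike.Xa 0 u θ) / Dfield θ (rayRadius CFNstxLike.U CFNstxLike.Xa 0 u θ)) ≠ 0)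
    (hA2 : (∫ θ in (0 : ℝ)..(2 * Real.pi), bsqKernel F CFNstxLike.Xa Dfield Gfield θ (rayRadius CFNstxLike.U CFNstxLike.Xa 0 u θ)) ≠ 0) :
    resistiveIndex F u
      = -(mercierRegisterForm F 1
          (∫ θ in (0 : ℝ)..(2 * Real.pi), polarKernelDs CFNstxLike.Xa Dfield F2field θ (rayRadius CFNstxLike.U CFNstxLike.Xa 0 u θ) / Dfield θ (rayRadius CFNstxLike.U CFNstxLike.Xa 0 u θ))
          (∫ θ in (0 : ℝ)..(2 * Real.pi), volKernelDs CFNstxLike.Xa Dfield F2field θ (rayRadius CFNstxLike.U CFNstxLike.Xa 0 u θ) / Dfield θ (rayRadius CFNstxLike.U CFNstxLike.Xa 0 u θ))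
          (∫ θ in (0 : ℝ)..(2 * Real.pi), invGradKernel CFNstxLike.Xa Dfield Gfield θ (rayRadius CFNstxLike.U CFNstxLike.Xa 0 u θ))
          (∫ θ in (0 : ℝ)..(2 * Real.pi), sigmaSqKernel F CFNstxLike.Xa Dfield Gfield θ (rayRadius CFNstxLike.U CFNstxLike.Xa 0 u θ))
          (∫ θ in (0 : ℝ)..(2 * Real.pi), bsqGradKernel F CFNstxLike.Xa Dfield Gfield θ (rayRadius CFNstxLike.U CFNstxLike.Xa 0 u θ))
          (∫ θ in (0 : ℝ)..(2 * Real.pi), invBsqKernel F CFNstxLike.Xa Dfield Gfield θ (rayRadius CFNstxLike.U CFNstxLike.Xa 0 u θ)))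
        / (4 * F ^ 2 * (∫ θ in (0 : ℝ)..(2 * Real.pi),
            polarKernelDs CFNstxLike.Xa Dfield F2field θ (rayRadius CFNstxLike.U CFNstxLike.Xa 0 u θ) / Dfield θ (rayRadius CFNstxLike.U CFNstxLike.Xa 0 u θ)) ^ 2)
      + (-(1 / (∫ θ in (0 : ℝ)..(2 * Real.pi),
              polarKernelDs CFNstxLike.Xa Dfield F2field θ (rayRadius CFNstxLike.U CFNstxLike.Xa 0 u θ) / Dfield θ (rayRadius CFNstxLike.U CFNstxLike.Xa 0 u θ)))
          * ((∫ θ in (0 : ℝ)..(2 * Real.pi), invGradKernel CFNstxLike.Xa Dfield Gfield θ (rayRadius CFNstxLike.U CFNstxLike.Xa 0 u θ))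
            - (∫ θ in (0 : ℝ)..(2 * Real.pi), bsqGradKernel F CFNstxLike.Xa Dfield Gfield θ (rayRadius CFNstxLike.U CFNstxLike.Xa 0 u θ))
              * (∫ θ in (0 : ℝ)..(2 * Real.pi), volKernel CFNstxLike.Xa Dfield θ (rayRadius CFNstxLike.U CFNstxLike.Xa 0 u θ))
              / ∫ θ in (0 : ℝ)..(2 * Real.pi), bsqKernel F CFNstxLike.Xa Dfield Gfield θ (rayRadius CFNstxLike.U CFNstxLike.Xa 0 u θ)) - 1 / 2) ^ 2 := by
  obtain ⟨-, -, hσ, hk, hkc, hkθc, hkθ, hkper, hm⟩ := fb_hyps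
  exact levelLoop.resistiveIndexE_eq_registerForm F box_facts.1 box_facts.2 box_facts₂.1 box_facts₂.2 box_factsG
    (fun k hk => continuousOn_Gfield_box hk) box_factsGS hσ hk hkc hkθc hkθ hkper hm hu hF hPd hA2

/-- **`D_R < 0 ⇒ (8.134)` ON THE SURFACE `CFNstxLike.U = u`** (GGJ's resistive-stable range implies Mercier; `F ≠ 0`, shear `Pd ≠ 0`).
[cite: Zheng2015, §3.2 eq. (3.42)] -/
theorem mercierCriterion_of_resistiveIndex_neg (hF : F ≠ 0)
    (hPd : (∫ θ in (0 : ℝ)..(2 * Real.pi),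
      polarKernelDs CFNstxLike.Xa Dfield F2field θ (rayRadius CFNstxLike.U CFNstxLike.Xa 0 u θ) / Dfield θ (rayRadius CFNstxLike.U CFNstxLike.Xa 0 u θ)) ≠ 0)
    (hneg : resistiveIndex F u < 0) : (ggjData F u).MercierCriterion := by
  obtain ⟨-, -, hσ, hk, hkc, hkθc, hkθ, hkper, hm⟩ := fb_hyps
  exact levelLoop.mercierCriterion_of_resistiveIndexE_neg F box_facts.1 box_facts.2 box_facts₂.1 box_facts₂.2 box_factsG
    (fun k hk => continuousOn_Gfield_box hk) hσ hk hkc hkθc hkθ hkper hm hu hF hPd hneg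

omit hu in
/-- Each full-loop register is twice the `[0, π]` register (up–down symmetry; `UN_neg`, even/periodic fields). -/
theorem registers_two_mul :
    (∫ θ in (0 : ℝ)..(2 * Real.pi), polarKernelDs CFNstxLike.Xa Dfield F2field θ (rayRadius CFNstxLike.U CFNstxLike.Xa 0 u θ) / Dfield θ (rayRadius CFNstxLike.U CFNstxLike.Xa 0 u θ))
        = 2 * ∫ θ in (0 : ℝ)..Real.pi, polarKernelDs CFNstxLike.Xa Dfield F2field θ (rayRadius CFNstxLike.U CFNstxLike.Xa 0 u θ) / Dfield θ (rayRadius CFNstxLike.U CFNstxLike.Xa 0 u θ)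
    ∧ (∫ θ in (0 : ℝ)..(2 * Real.pi), volKernelDs CFNstxLike.Xa Dfield F2field θ (rayRadius CFNstxLike.U CFNstxLike.Xa 0 u θ) / Dfield θ (rayRadius CFNstxLike.U CFNstxLike.Xa 0 u θ))
        = 2 * ∫ θ in (0 : ℝ)..Real.pi, volKernelDs CFNstxLike.Xa Dfield F2field θ (rayRadius CFNstxLike.U CFNstxLike.Xa 0 u θ) / Dfield θ (rayRadius CFNstxLike.U CFNstxLike.Xa 0 u θ)
    ∧ (∫ θ in (0 : ℝ)..(2 * Real.pi), invGradKernel CFNstxLike.Xa Dfield Gfield θ (rayRadius CFNstxLike.U CFNstxLike.Xa 0 u θ))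
        = 2 * ∫ θ in (0 : ℝ)..Real.pi, invGradKernel CFNstxLike.Xa Dfield Gfield θ (rayRadius CFNstxLike.U CFNstxLike.Xa 0 u θ)
    ∧ (∫ θ in (0 : ℝ)..(2 * Real.pi), sigmaSqKernel F CFNstxLike.Xa Dfield Gfield θ (rayRadius CFNstxLike.U CFNstxLike.Xa 0 u θ))
        = 2 * ∫ θ in (0 : ℝ)..Real.pi, sigmaSqKernel F CFNstxLike.Xa Dfield Gfield θ (rayRadius CFNstxLike.U CFNstxLike.Xa 0 u θ)
    ∧ (∫ θ in (0 : ℝ)..(2 * Real.pi), bsqGradKernel F CFNstxLike.Xa Dfield Gfield θ (rayRadius CFNstxLike.U CFNstxLike.Xa 0 u θ))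
        = 2 * ∫ θ in (0 : ℝ)..Real.pi, bsqGradKernel F CFNstxLike.Xa Dfield Gfield θ (rayRadius CFNstxLike.U CFNstxLike.Xa 0 u θ)
    ∧ (∫ θ in (0 : ℝ)..(2 * Real.pi), invBsqKernel F CFNstxLike.Xa Dfield Gfield θ (rayRadius CFNstxLike.U CFNstxLike.Xa 0 u θ))
        = 2 * ∫ θ in (0 : ℝ)..Real.pi, invBsqKernel F CFNstxLike.Xa Dfield Gfield θ (rayRadius CFNstxLike.U CFNstxLike.Xa 0 u θ)
    ∧ (∫ θ in (0 : ℝ)..(2 * Real.pi), volKernel CFNstxLike.Xa Dfield θ (rayRadius CFNstxLike.U CFNstxLike.Xa 0 u θ))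
        = 2 * ∫ θ in (0 : ℝ)..Real.pi, volKernel CFNstxLike.Xa Dfield θ (rayRadius CFNstxLike.U CFNstxLike.Xa 0 u θ)
    ∧ (∫ θ in (0 : ℝ)..(2 * Real.pi), bsqKernel F CFNstxLike.Xa Dfield Gfield θ (rayRadius CFNstxLike.U CFNstxLike.Xa 0 u θ))
        = 2 * ∫ θ in (0 : ℝ)..Real.pi, bsqKernel F CFNstxLike.Xa Dfield Gfield θ (rayRadius CFNstxLike.U CFNstxLike.Xa 0 u θ) := by
  have hcn : ∀ θ : ℝ, Real.cos (-θ) = Real.cos θ := fun θ => Real.cos_neg θ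
  have hcp : ∀ θ : ℝ, Real.cos (θ + 2 * Real.pi) = Real.cos θ := fun θ => Real.cos_add_two_pi θ
  refine ⟨?_, ?_, ?_, ?_, ?_, ?_, ?_, ?_⟩
  · exact integral_rayRadius_kernel_eq_two_mul U_symm (k := fun θ s => polarKernelDs CFNstxLike.Xa Dfield F2field θ s / Dfield θ s)
      (fun θ s => polarKernelDs_div_congr_theta (hcn θ) (Dfield_neg θ s) (F2field_neg θ s))
      (fun θ s => polarKernelDs_div_congr_theta (hcp θ) (Dfield_periodic θ s) (F2field_periodic θ s)) u
  · exact integral_rayRadius_kernel_eq_two_mul U_symm (k := fun θ s => volKernelDs CFNstxLike.Xa Dfield F2field θ s / Dfield θ s)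
      (fun θ s => volKernelDs_div_congr_theta (hcn θ) (Dfield_neg θ s) (F2field_neg θ s))
      (fun θ s => volKernelDs_div_congr_theta (hcp θ) (Dfield_periodic θ s) (F2field_periodic θ s)) u
  · exact integral_rayRadius_kernel_eq_two_mul U_symm (k := fun θ s => invGradKernel CFNstxLike.Xa Dfield Gfield θ s)
      (fun θ s => invGradKernel_congr_theta (hcn θ) (Dfield_neg θ s) (Gfield_neg θ s))
      (fun θ s => invGradKernel_congr_theta (hcp θ) (Dfield_periodic θ s) (Gfield_periodic θ s)) u
  · exact integral_rayRadius_kernel_eq_two_mul U_symm (k := fun θ s => sigmaSqKernel F CFNstxLike.Xa Dfield Gfield θ s)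
      (fun θ s => sigmaSqKernel_congr_theta (hcn θ) (Dfield_neg θ s) (Gfield_neg θ s))
      (fun θ s => sigmaSqKernel_congr_theta (hcp θ) (Dfield_periodic θ s) (Gfield_periodic θ s)) u
  · exact integral_rayRadius_kernel_eq_two_mul U_symm (k := fun θ s => bsqGradKernel F CFNstxLike.Xa Dfield Gfield θ s)
      (fun θ s => bsqGradKernel_congr_theta (hcn θ) (Dfield_neg θ s) (Gfield_neg θ s))
      (fun θ s => bsqGradKernel_congr_theta (hcp θ) (Dfield_periodic θ s) (Gfield_periodic θ s)) u
  · exact integral_rayRadius_kernel_eq_two_mul U_symm (k := fun θ s => invBsqKernel F CFNstxLike.Xa Dfield Gfield θ s)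
      (fun θ s => invBsqKernel_congr_theta (hcn θ) (Dfield_neg θ s) (Gfield_neg θ s))
      (fun θ s => invBsqKernel_congr_theta (hcp θ) (Dfield_periodic θ s) (Gfield_periodic θ s)) u
  · exact integral_rayRadius_kernel_eq_two_mul U_symm (k := fun θ s => volKernel CFNstxLike.Xa Dfield θ s)
      (fun θ s => volKernel_congr_theta (hcn θ) (Dfield_neg θ s))
      (fun θ s => volKernel_congr_theta (hcp θ) (Dfield_periodic θ s)) u
  · exact integral_rayRadius_kernel_eq_two_mul U_symm (k := fun θ s => bsqKernel F CFNstxLike.Xa Dfield Gfield θ s)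
      (fun θ s => bsqKernel_congr_theta (hcn θ) (Dfield_neg θ s) (Gfield_neg θ s))
      (fun θ s => bsqKernel_congr_theta (hcp θ) (Dfield_periodic θ s) (Gfield_periodic θ s)) u

/-- **`D_R` OF THE SURFACE `CFNstxLike.U = u` WITH THE EIGHT `[0, π]` REGISTERS** (the 32-panel program's shape; `D_R` is scale-invariant in the
registers, so no doubling is needed). [cite: Zheng2015, §3.2 eq. (3.42)] -/
theorem resistiveIndex_eq_registerForm_halfLoop (hF : F ≠ 0)
    (hPd : (∫ θ in (0 : ℝ)..Real.pi,
      polarKernelDs CFNstxLike.Xa Dfield F2field θ (rayRadius CFNstxLike.U CFNstxLike.Xa 0 u θ) / Dfield θ (rayRadius CFNstxLike.U CFNstxLike.Xa 0 u θ)) ≠ 0)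
    (hA2 : (∫ θ in (0 : ℝ)..Real.pi, bsqKernel F CFNstxLike.Xa Dfield Gfield θ (rayRadius CFNstxLike.U CFNstxLike.Xa 0 u θ)) ≠ 0) :
    resistiveIndex F u
      = -(mercierRegisterForm F 1
          (∫ θ in (0 : ℝ)..Real.pi, polarKernelDs CFNstxLike.Xa Dfield F2field θ (rayRadius CFNstxLike.U CFNstxLike.Xa 0 u θ) / Dfield θ (rayRadius CFNstxLike.U CFNstxLike.Xa 0 u θ))
          (∫ θ in (0 : ℝ)..Real.pi, volKernelDs CFNstxLike.Xa Dfield F2field θ (rayRadius CFNstxLike.U CFNstxLike.Xa 0 u θ) / Dfield θ (rayRadius CFNstxLike.U CFNstxLike.Xa 0 u θ))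
          (∫ θ in (0 : ℝ)..Real.pi, invGradKernel CFNstxLike.Xa Dfield Gfield θ (rayRadius CFNstxLike.U CFNstxLike.Xa 0 u θ))
          (∫ θ in (0 : ℝ)..Real.pi, sigmaSqKernel F CFNstxLike.Xa Dfield Gfield θ (rayRadius CFNstxLike.U CFNstxLike.Xa 0 u θ))
          (∫ θ in (0 : ℝ)..Real.pi, bsqGradKernel F CFNstxLike.Xa Dfield Gfield θ (rayRadius CFNstxLike.U CFNstxLike.Xa 0 u θ))
          (∫ θ in (0 : ℝ)..Real.pi, invBsqKernel F CFNstxLike.Xa Dfield Gfield θ (rayRadius CFNstxLike.U CFNstxLike.Xa 0 u θ)))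
        / (4 * F ^ 2 * (∫ θ in (0 : ℝ)..Real.pi,
            polarKernelDs CFNstxLike.Xa Dfield F2field θ (rayRadius CFNstxLike.U CFNstxLike.Xa 0 u θ) / Dfield θ (rayRadius CFNstxLike.U CFNstxLike.Xa 0 u θ)) ^ 2)
      + (-(1 / (∫ θ in (0 : ℝ)..Real.pi,
              polarKernelDs CFNstxLike.Xa Dfield F2field θ (rayRadius CFNstxLike.U CFNstxLike.Xa 0 u θ) / Dfield θ (rayRadius CFNstxLike.U CFNstxLike.Xa 0 u θ)))
          * ((∫ θ in (0 : ℝ)..Real.pi, invGradKernel CFNstxLike.Xa Dfield Gfield θ (rayRadius CFNstxLike.U CFNstxLike.Xa 0 u θ))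
            - (∫ θ in (0 : ℝ)..Real.pi, bsqGradKernel F CFNstxLike.Xa Dfield Gfield θ (rayRadius CFNstxLike.U CFNstxLike.Xa 0 u θ))
              * (∫ θ in (0 : ℝ)..Real.pi, volKernel CFNstxLike.Xa Dfield θ (rayRadius CFNstxLike.U CFNstxLike.Xa 0 u θ))
              / ∫ θ in (0 : ℝ)..Real.pi, bsqKernel F CFNstxLike.Xa Dfield Gfield θ (rayRadius CFNstxLike.U CFNstxLike.Xa 0 u θ)) - 1 / 2) ^ 2 := by
  obtain ⟨e1, e2, e3, e4, e5, e6, e7, e8⟩ := registers_two_mul (u := u) F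
  have hPd' : (∫ θ in (0 : ℝ)..(2 * Real.pi),
      polarKernelDs CFNstxLike.Xa Dfield F2field θ (rayRadius CFNstxLike.U CFNstxLike.Xa 0 u θ) / Dfield θ (rayRadius CFNstxLike.U CFNstxLike.Xa 0 u θ)) ≠ 0 := by
    rw [e1]; exact mul_ne_zero two_ne_zero hPd
  have hA2' : (∫ θ in (0 : ℝ)..(2 * Real.pi), bsqKernel F CFNstxLike.Xa Dfield Gfield θ (rayRadius CFNstxLike.U CFNstxLike.Xa 0 u θ)) ≠ 0 := by
    rw [e8]; exact mul_ne_zero two_ne_zero hA2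
  rw [resistiveIndex_eq_registerForm hu F hF hPd' hA2', e1, e2, e3, e4, e5, e6, e7, e8, mercierRegisterForm_smul]
  set Pd := ∫ θ in (0 : ℝ)..Real.pi, polarKernelDs CFNstxLike.Xa Dfield F2field θ (rayRadius CFNstxLike.U CFNstxLike.Xa 0 u θ) / Dfield θ (rayRadius CFNstxLike.U CFNstxLike.Xa 0 u θ)
  set A2 := ∫ θ in (0 : ℝ)..Real.pi, bsqKernel F CFNstxLike.Xa Dfield Gfield θ (rayRadius CFNstxLike.U CFNstxLike.Xa 0 u θ)
  set Aσ := ∫ θ in (0 : ℝ)..Real.pi, invGradKernel CFNstxLike.Xa Dfield Gfield θ (rayRadius CFNstxLike.U CFNstxLike.Xa 0 u θ)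
  set AB := ∫ θ in (0 : ℝ)..Real.pi, bsqGradKernel F CFNstxLike.Xa Dfield Gfield θ (rayRadius CFNstxLike.U CFNstxLike.Xa 0 u θ)
  set W := ∫ θ in (0 : ℝ)..Real.pi, volKernel CFNstxLike.Xa Dfield θ (rayRadius CFNstxLike.U CFNstxLike.Xa 0 u θ)
  set rf := mercierRegisterForm F 1 Pd
    (∫ θ in (0 : ℝ)..Real.pi, volKernelDs CFNstxLike.Xa Dfield F2field θ (rayRadius CFNstxLike.U CFNstxLike.Xa 0 u θ) / Dfield θ (rayRadius CFNstxLike.U CFNstxLike.Xa 0 u θ)) Aσ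
    (∫ θ in (0 : ℝ)..Real.pi, sigmaSqKernel F CFNstxLike.Xa Dfield Gfield θ (rayRadius CFNstxLike.U CFNstxLike.Xa 0 u θ)) AB
    (∫ θ in (0 : ℝ)..Real.pi, invBsqKernel F CFNstxLike.Xa Dfield Gfield θ (rayRadius CFNstxLike.U CFNstxLike.Xa 0 u θ))
  have h2 : (2 : ℝ) ≠ 0 := two_ne_zero
  congr 1
  · field_simp
  · congr 1
    field_simp

end levels

end Summit.Ventures.FusionMHD.Models.CFNstxLike.QHalf

end
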